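import Mathlib
import HarnessLib
import Summits.NavierStokesRegularity.NavierStokesRegularity.Theses.HardyPointSink
import Literature.Analysis.FluidPDE.LocalTypeICharacterization
import Summits.NavierStokesRegularity.NavierStokesRegularity.Theorems.HardyPointSinkABForwardHardyEngine
import Summits.NavierStokesRegularity.NavierStokesRegularity.Theorems.HardyPointSinkABForwardHardyApproximants
import Summits.NavierStokesRegularity.NavierStokesRegularity.Theorems.HardyPointSinkABForwardHardyLimits
import Summits.NavierStokesRegularity.NavierStokesRegularity.Theorems.HardyPointSinkABForwardHardyHardyScaling
import Summits.NavierStokesRegularity.NavierStokesRegularity.Theorems.HardyPointSinkABForwardHardyNontrivial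
import Summits.NavierStokesRegularity.NavierStokesRegularity.Theorems.HardyPointSinkABForwardHardyMild

/-!
# Route HardyPointSink — support `ABForwardHardy` (item stmt-NavierStokesRegularity-7983): assembly

**Albritton–Barker 2019, Thm. 1.1, forward direction, carrying the Hardy bound.**  A Hardy-bounded
local Type I singular point — a suitable weak solution `(u, p)` in a parabolic ball `Q(z, r₀)`
whose vertex is backward singular, with `𝐈(Q(z, r₀)) < ∞` and
`∫_{B(x*,r₀)} |u(t,x)|² |x − x₀|⁻¹ dx ≤ K` for all centres `x₀ ∈ B(x*, r₀)` and a.e. `t` — yields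
a non-trivial mild bounded ancient solution (`ν = 1`) with measurable slices, suitable on
`(EuclideanSpace ℝ (Fin 3)) × ℝ₋` with a pressure and a weak gradient, `𝐈 < ∞`, and the global Hardy bound with the
same constant `K` (`abForwardHardy_proof`).  Proof (A–B §3 / Seregin–Šverák 2009, Thm. 2.8, with
the point-picking and compactness organisation of the helper files):

1. rescale `Q(z, r₀)` to the unit ball (the class, the weak gradient, `𝐈`, the backward
   singularity and the Hardy bound are scale invariant);
2. the blow-up sequence of file `…Approximants` (clean vertex, point picking, zooms bounded by
   `1` on `Q(0, 2^{k+1})` with `‖v_k(0,0)‖ = 1/2`);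
3. the slab limit `(U, P, H)` of file `…Engine` (`𝐈 ≤ 4 𝐈(Q(z, r₀))`, strong `L³_loc`
   convergence), bounded by `1` a.e. (file `…Limits`), truncated to a pointwise bound;
4. the continuous Oseen-mild representative of file `…Mild`, a mild bounded ancient solution
   with measurable slices; non-trivial by the uniform `L³` mass of file `…Nontrivial`; Hardy
   bounded by files `…HardyScaling` (scale invariance) and `…Limits` (Fatou), exhausting
   `(EuclideanSpace ℝ (Fin 3))` by the balls `B(0, n+1)`.

## References

* D. Albritton, T. Barker, J. Math. Fluid Mech. 21 (2019) = arXiv:1811.00502, Thm. 1.1, §3.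
* G. Seregin, V. Šverák, Comm. PDE 34 (2009) = arXiv:0804.1803, §2, Thm. 2.8.
* G. Koch, N. Nadirashvili, G. Seregin, V. Šverák, Acta Math. 203 (2009), §6.
-/

noncomputable section

open MeasureTheory Set Function Filter Topology TopologicalSpace Metric
open scoped NNReal ENNReal
open Literature.Analysis Literature.Analysis.FluidPDE

-- single-problem summit: the namespace repeats the summit name by design (CONVENTIONS §1)
set_option linter.dupNamespace false

namespace Summit.NavierStokesRegularity.NavierStokesRegularity.Theorems

open HardyPointSinkABForwardHardy

/-- The backward slab is exhausted by the balls `Q(0, n+1)`. -/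
theorem HardyPointSinkABForwardHardy.lowerHalf_subset_iUnion :
    (Iio (0 : ℝ) ×ˢ (univ : Set (EuclideanSpace ℝ (Fin 3)))) ⊆ ⋃ n : ℕ, parabolicCylinder ((n : ℝ) + 1) (0 : ℝ × (EuclideanSpace ℝ (Fin 3))) := by
  rintro ⟨t, x⟩ ⟨ht, -⟩
  obtain ⟨n, hn⟩ := exists_nat_ge (‖x‖ - t)
  refine mem_iUnion.2 ⟨n, ?_⟩
  rw [mem_parabolicCylinder]
  simp only [Prod.fst_zero, Prod.snd_zero, zero_sub, dist_zero_right]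
  have ht' : t < 0 := ht
  have hx : 0 ≤ ‖x‖ := norm_nonneg x
  refine ⟨⟨?_, ht'⟩, by linarith⟩
  nlinarith

/-- **The blow-up of a local Type I singular point, with the Hardy bound carried along**
(Albritton–Barker 2019, Thm. 1.1, forward direction; module docstring).  From a local Type I
singular point (`IsLocalTypeISingularPoint r₀ z u p`) we obtain a mild bounded ancient solution
`V` (`ν = 1`) with continuous, hence measurable, slices, a pressure `P` and a weak gradient `H`
making it suitable on `(EuclideanSpace ℝ (Fin 3)) × ℝ₋` with `𝐈 < ∞`, non-trivial, and such that every local Hardy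
bound of `u` on `Q(z, r₀)` (any constant `K`, all centres of `B(z.2, r₀)`, a.e. time) is
inherited by `V` on the whole space with the same constant.
[cite: AlbrittonBarker2019, Thm 1.1 and §3; SereginSverak2009, Thm 2.8] -/
theorem HardyPointSinkABForwardHardy.exists_hardyAncient_of_localTypeI {r₀ : ℝ} {z : ℝ × (EuclideanSpace ℝ (Fin 3))}
    {u : ℝ → (EuclideanSpace ℝ (Fin 3)) → (EuclideanSpace ℝ (Fin 3))} {p : ℝ → (EuclideanSpace ℝ (Fin 3)) → ℝ} (hloc : IsLocalTypeISingularPoint r₀ z u p) :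
    ∃ (V : ℝ → (EuclideanSpace ℝ (Fin 3)) → (EuclideanSpace ℝ (Fin 3))) (P : ℝ → (EuclideanSpace ℝ (Fin 3)) → ℝ) (H : ℝ → (EuclideanSpace ℝ (Fin 3)) → (EuclideanSpace ℝ (Fin 3)) →L[ℝ] (EuclideanSpace ℝ (Fin 3))),
      (∀ t < 0, AEStronglyMeasurable (V t) volume) ∧
      IsBoundedAncientMildSolution 1 V ∧
      IsSuitableWeakSolutionOn (slab (EuclideanSpace ℝ (Fin 3)) (Iio 0) isOpen_Iio) 1 0 V P ∧
      HasWeakSpatialGradientOn (slab (EuclideanSpace ℝ (Fin 3)) (Iio 0) isOpen_Iio) V H ∧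
      ¬ (uncurry V =ᵐ[volume.restrict (Iio (0 : ℝ) ×ˢ (univ : Set (EuclideanSpace ℝ (Fin 3))))] 0) ∧
      typeIBound (Iio (0 : ℝ) ×ˢ (univ : Set (EuclideanSpace ℝ (Fin 3)))) V P H < ⊤ ∧
      ∀ K : ℝ≥0∞, (∀ x₀ ∈ ball z.2 r₀, ∀ᵐ t ∂(volume.restrict (Ioo (z.1 - r₀ ^ 2) z.1)),
          ∫⁻ x in ball z.2 r₀, ‖u t x‖ₑ ^ 2 / ‖x - x₀‖ₑ ≤ K) →
        ∀ x₀ : (EuclideanSpace ℝ (Fin 3)), ∀ᵐ t ∂(volume.restrict (Iio (0 : ℝ))), ∫⁻ x, ‖V t x‖ₑ ^ 2 / ‖x - x₀‖ₑ ≤ K := by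
  obtain ⟨hr₀, hball, hsing, G, hwg, hI⟩ := hloc
  -- ## Step 1: rescale to the unit ball
  set u₁ : ℝ → (EuclideanSpace ℝ (Fin 3)) → (EuclideanSpace ℝ (Fin 3)) := r₀ • stPull (r₀ ^ 2) r₀ z.1 z.2 u with hu₁
  set p₁ : ℝ → (EuclideanSpace ℝ (Fin 3)) → ℝ := r₀ ^ 2 • stPull (r₀ ^ 2) r₀ z.1 z.2 p with hp₁
  set G₁ : ℝ → (EuclideanSpace ℝ (Fin 3)) → (EuclideanSpace ℝ (Fin 3)) →L[ℝ] (EuclideanSpace ℝ (Fin 3)) := r₀ ^ 2 • stPull (r₀ ^ 2) r₀ z.1 z.2 G with hG₁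
  have hball1 : IsSuitableWeakSolutionInBall 1 (0 : ℝ × (EuclideanSpace ℝ (Fin 3))) u₁ p₁ := hball.zoom hr₀
  have hwg1 : HasWeakSpatialGradientOn (parabolicCylinderOpens 1 (0 : ℝ × (EuclideanSpace ℝ (Fin 3)))) u₁ G₁ := by
    have h := hwg.stRescale r₀ (β := r₀ ^ 2) (γ := r₀) (pow_pos hr₀ 2) hr₀ z.1 z.2
    rw [zoom_stPreimage_parabolicCylinderOpens hr₀ z, show r₀ * r₀ = r₀ ^ 2 by ring] at h
    exact h
  have hI1 : typeIBound (parabolicCylinder 1 (0 : ℝ × (EuclideanSpace ℝ (Fin 3)))) u₁ p₁ G₁ =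
      typeIBound (parabolicCylinder r₀ z) u p G := by
    rw [← zoom_preimage_parabolicCylinder_self hr₀ z]
    exact typeIBound_nsZoom hr₀ z.1 z.2 _ u p G
  have hst0 : stAffine (r₀ ^ 2) r₀ z.1 z.2 0 = z := by
    rw [show (0 : ℝ × (EuclideanSpace ℝ (Fin 3))) = ((0 : ℝ), (0 : (EuclideanSpace ℝ (Fin 3)))) from rfl, stAffine_apply, mul_zero, add_zero,
      smul_zero, add_zero]
  have hsing1 : IsBackwardSingularPoint u₁ 0 := by
    intro r hr
    rw [hu₁, eLpNorm_top_nsZoom hr₀ z.1 z.2 r 0 u, hst0, hsing (r₀ * r) (mul_pos hr₀ hr),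
      ENNReal.mul_top (ENNReal.ofReal_pos.2 hr₀).ne']
  have hHardy1 : ∀ K : ℝ≥0∞, (∀ x₀ ∈ ball z.2 r₀, ∀ᵐ t ∂(volume.restrict (Ioo (z.1 - r₀ ^ 2) z.1)),
        ∫⁻ x in ball z.2 r₀, ‖u t x‖ₑ ^ 2 / ‖x - x₀‖ₑ ≤ K) →
      ∀ x₀ ∈ ball (0 : (EuclideanSpace ℝ (Fin 3))) 1, ∀ᵐ t ∂(volume.restrict (Ioo (-1 : ℝ) 0)),
        ∫⁻ x in ball (0 : (EuclideanSpace ℝ (Fin 3))) 1, ‖u₁ t x‖ₑ ^ 2 / ‖x - x₀‖ₑ ≤ K := by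
    intro K hHardy x₀ hx₀
    have hc : z.2 + r₀ • x₀ ∈ ball z.2 r₀ := by
      rw [mem_ball, dist_eq_norm, add_sub_cancel_left, norm_smul, Real.norm_of_nonneg hr₀.le]
      have : ‖x₀‖ < 1 := by simpa using hx₀
      nlinarith
    have h1 := hHardy _ hc
    have h2 : Ioo (z.1 + r₀ ^ 2 * (-1)) (z.1 + r₀ ^ 2 * 0) = Ioo (z.1 - r₀ ^ 2) z.1 := by ring_nf
    rw [← h2] at h1
    filter_upwards [ae_restrict_Ioo_comp_time_affine (pow_pos hr₀ 2) z.1 (-1) 0 h1] with t ht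
    rw [hu₁, hardy_zoom u hr₀, mul_one]
    exact ht
  -- ## Step 2: the blow-up sequence
  obtain ⟨v, q, Gz, zs, lam, uh, hlam, hae, hvform, hbox, hballs, hgrads, hIs, hbd1, hvtx, hcontAt,
    hcontOn⟩ := exists_approximants hball1 hwg1 hsing1
  have hI₀top : typeIBound (parabolicCylinder 1 (0 : ℝ × (EuclideanSpace ℝ (Fin 3)))) u₁ p₁ G₁ < ⊤ := by
    rw [hI1]; exact hI
  -- ## Step 3: the slab limit
  obtain ⟨U, P, H, σ, hσ, hswU, hHU, h4I, hmemU, hconvU⟩ :=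
    local_typeI_compactness (typeIBound (parabolicCylinder 1 (0 : ℝ × (EuclideanSpace ℝ (Fin 3)))) u₁ p₁ G₁) v q Gz hI₀top
      hballs hgrads fun m k hmk => hIs m k hmk
  -- shifted subsequences `σ' j = σ (j + m)` stay above the level `m`
  have hσge : ∀ m j, m ≤ σ (j + m) := fun m j => (Nat.le_add_left m j).trans (hσ.id_le (j + m))
  have hlevel : ∀ R : ℝ, ∃ m : ℕ, R ≤ (2 : ℝ) ^ m := fun R => by
    obtain ⟨m, hm⟩ := pow_unbounded_of_one_lt R (by norm_num : (1 : ℝ) < 2)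
    exact ⟨m, hm.le⟩
  have hmeas : ∀ m k : ℕ, m ≤ k → ∀ {R : ℝ}, 0 < R → R ≤ (2 : ℝ) ^ m →
      AEStronglyMeasurable (uncurry (v k)) (volume.restrict (parabolicCylinder R (0 : ℝ × (EuclideanSpace ℝ (Fin 3))))) := by
    intro m k hmk R hR0 hR
    exact (hballs m k hmk).1.distributional.1.aestronglyMeasurable.mono_measure
      (Measure.restrict_mono (parabolicCylinder_mono hR0.le hR _) le_rfl)
  -- ## Step 4: `‖U‖ ≤ 1` a.e. on the slab, and the truncation
  have hUbd : ∀ R : ℝ, 0 < R → ∀ᵐ w ∂(volume.restrict (parabolicCylinder R (0 : ℝ × (EuclideanSpace ℝ (Fin 3))))),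
      ‖uncurry U w‖ ≤ 1 := by
    intro R hR
    obtain ⟨m, hm⟩ := hlevel R
    refine ae_norm_le_of_tendsto_eLpNorm (v := fun j => v (σ (j + m)))
      (fun j => hmeas m _ (hσge m j) hR hm) (hmemU R hR).1
      ((hconvU R hR).comp (tendsto_add_atTop_nat m)) fun j => ?_
    filter_upwards [ae_restrict_mem (isOpen_parabolicCylinder R (0 : ℝ × (EuclideanSpace ℝ (Fin 3)))).measurableSet]
      with w hw
    refine hbd1 _ w (parabolicCylinder_mono hR.le (hm.trans ?_) _ hw)
    exact pow_le_pow_right₀ (by norm_num) (by linarith [hσge m j])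
  have hUbd' : ∀ᵐ w ∂(volume.restrict (Iio (0 : ℝ) ×ˢ (univ : Set (EuclideanSpace ℝ (Fin 3))))), ‖uncurry U w‖ ≤ 1 := by
    refine ae_restrict_of_ae_restrict_of_subset lowerHalf_subset_iUnion ?_
    rw [ae_restrict_iUnion_iff]
    exact fun n => hUbd _ (by positivity)
  classical
  set Ut : ℝ → (EuclideanSpace ℝ (Fin 3)) → (EuclideanSpace ℝ (Fin 3)) := fun t x => if ‖U t x‖ ≤ 1 then U t x else 0 with hUt
  have hUt_bd : ∀ t x, ‖Ut t x‖ ≤ 1 := fun t x => by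
    simp only [hUt]
    split_ifs with h
    · exact h
    · simp
  have hUt_ae : ∀ᵐ w ∂(volume.restrict (Iio (0 : ℝ) ×ˢ (univ : Set (EuclideanSpace ℝ (Fin 3))))), uncurry U w = uncurry Ut w := by
    filter_upwards [hUbd'] with w hw
    rcases w with ⟨t, x⟩
    show U t x = Ut t x
    simp only [hUt, if_pos (show ‖U t x‖ ≤ 1 from hw)]
  have hslab : ((slab (EuclideanSpace ℝ (Fin 3)) (Iio 0) isOpen_Iio : Opens (ℝ × (EuclideanSpace ℝ (Fin 3)))) : Set (ℝ × (EuclideanSpace ℝ (Fin 3)))) =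
      Iio (0 : ℝ) ×ˢ (univ : Set (EuclideanSpace ℝ (Fin 3))) := coe_slab _ _
  have hUt_ae' : ∀ᵐ w ∂(volume.restrict ((slab (EuclideanSpace ℝ (Fin 3)) (Iio 0) isOpen_Iio : Opens (ℝ × (EuclideanSpace ℝ (Fin 3)))) : Set (ℝ × (EuclideanSpace ℝ (Fin 3))))),
      uncurry U w = uncurry Ut w := by rw [hslab]; exact hUt_ae
  have hswUt : IsSuitableWeakSolutionOn (slab (EuclideanSpace ℝ (Fin 3)) (Iio 0) isOpen_Iio) 1 0 Ut P :=
    hswU.congr_ae hUt_ae' (ae_of_all _ fun _ => rfl)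
  have hIUt : typeIBound (Iio (0 : ℝ) ×ˢ univ) Ut P H ≤
      4 * typeIBound (parabolicCylinder 1 (0 : ℝ × (EuclideanSpace ℝ (Fin 3)))) u₁ p₁ G₁ := by
    rw [← typeIBound_congr_ae (p := P) (G := H) hUt_ae]; exact h4I
  have hIUt_top : typeIBound (Iio (0 : ℝ) ×ˢ univ) Ut P H < ⊤ :=
    lt_of_le_of_lt hIUt (ENNReal.mul_lt_top (by norm_num) hI₀top)
  -- ## Step 5: the mild representative
  obtain ⟨V, hVae, hVc, hVmild⟩ := exists_boundedAncientMild_repr hswUt (fun t _ x => hUt_bd t x) hIUt_top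
  have hUV : ∀ᵐ w ∂(volume.restrict (Iio (0 : ℝ) ×ˢ (univ : Set (EuclideanSpace ℝ (Fin 3))))), uncurry U w = uncurry V w := by
    filter_upwards [hUt_ae, hVae] with w h1 h2
    rw [h1, h2]
  have hUV' : ∀ᵐ w ∂(volume.restrict ((slab (EuclideanSpace ℝ (Fin 3)) (Iio 0) isOpen_Iio : Opens (ℝ × (EuclideanSpace ℝ (Fin 3)))) : Set (ℝ × (EuclideanSpace ℝ (Fin 3))))),
      uncurry Ut w = uncurry V w := by rw [hslab]; exact hVae
  refine ⟨V, P, H, fun t ht => ?_, hVmild, hswUt.congr_ae hUV' (ae_of_all _ fun _ => rfl),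
    (hHU.congr_ae hUt_ae').congr_ae hUV', ?_, ?_, fun K hHK x₀ => ?_⟩
  · -- measurable slices (continuity)
    exact (hVc.comp_continuous (f := fun x : (EuclideanSpace ℝ (Fin 3)) => (t, x)) (by fun_prop)
      fun x => ⟨ht, mem_univ _⟩).aestronglyMeasurable
  · -- ## Step 6: non-triviality
    intro hV0
    have hU0 : ∀ᵐ w ∂(volume.restrict (parabolicCylinder 1 (0 : ℝ × (EuclideanSpace ℝ (Fin 3))))), uncurry U w = 0 := by
      refine ae_restrict_of_ae_restrict_of_subset (parabolicCylinder_subset_lowerHalf le_rfl 1) ?_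
      filter_upwards [hUV, hV0] with w h1 h2
      rw [h1, h2]
      rfl
    obtain ⟨m₀, hm₀, hlow⟩ := exists_eLpNorm_lower_bound hI₀top hballs
      (fun m k hmk => hIs m k hmk) hbd1 hvtx hcontAt hcontOn
    have hconv1 := (hconvU 1 one_pos).comp (tendsto_add_atTop_nat 3)
    have hle : ∀ j, m₀ ≤ eLpNorm (uncurry (v (σ (j + 3))) - uncurry U) 3
        (volume.restrict (parabolicCylinder 1 (0 : ℝ × (EuclideanSpace ℝ (Fin 3))))) := by
      intro j
      have hk : 3 ≤ σ (j + 3) := hσge 3 j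
      refine (hlow _ hk).trans (le_of_eq (eLpNorm_congr_ae ?_))
      filter_upwards [hU0] with w hw
      rw [Pi.sub_apply, hw, sub_zero]
    have : m₀ ≤ 0 := ge_of_tendsto' hconv1 hle
    exact hm₀.ne' (le_antisymm this bot_le)
  · -- `𝐈 < ⊤`
    rw [← typeIBound_congr_ae (p := P) (G := H) hVae]
    exact hIUt_top
  · -- ## Step 7: the Hardy bound, with the same constant
    -- per ball `B(0, n+1)`: the bound for `U` (scale invariance + Fatou)
    have hUH : ∀ n : ℕ, ∀ᵐ s ∂(volume.restrict (Ioo (-((n : ℝ) + 1) ^ 2) 0)),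
        ∫⁻ y in ball (0 : (EuclideanSpace ℝ (Fin 3))) ((n : ℝ) + 1), ‖U s y‖ₑ ^ 2 / ‖y - x₀‖ₑ ≤ K := by
      intro n
      have hR : (0 : ℝ) < (n : ℝ) + 1 := by positivity
      obtain ⟨k₀, hk₀⟩ := eventually_atTop.1 (hardy_approximants hlam hae hvform hbox (hHardy1 K hHK) hR x₀)
      obtain ⟨m₁, hm₁⟩ := hlevel ((n : ℝ) + 1)
      have hm : (n : ℝ) + 1 ≤ (2 : ℝ) ^ (max k₀ m₁) :=
        hm₁.trans (pow_le_pow_right₀ (by norm_num) (le_max_right _ _))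
      exact hardy_le_of_tendsto_eLpNorm (v := fun j => v (σ (j + max k₀ m₁)))
        (fun j => hmeas (max k₀ m₁) _ (hσge _ j) hR hm) (hmemU _ hR).1
        ((hconvU _ hR).comp (tendsto_add_atTop_nat (max k₀ m₁)))
        fun j => hk₀ _ ((le_max_left _ _).trans (hσge _ j))
    -- `U = V` slice-wise, a.e. in time
    have hUVs : ∀ᵐ s ∂(volume.restrict (Iio (0 : ℝ))), ∀ᵐ y ∂(volume : Measure (EuclideanSpace ℝ (Fin 3))), U s y = V s y := by
      have h : ∀ᵐ w ∂((volume.restrict (Iio (0 : ℝ))).prod (volume : Measure (EuclideanSpace ℝ (Fin 3)))),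
          uncurry U w = uncurry V w := by
        have e : ((volume.restrict (Iio (0 : ℝ))).prod (volume : Measure (EuclideanSpace ℝ (Fin 3)))) =
            (volume : Measure (ℝ × (EuclideanSpace ℝ (Fin 3)))).restrict (Iio (0 : ℝ) ×ˢ (univ : Set (EuclideanSpace ℝ (Fin 3)))) := by
          rw [Measure.volume_eq_prod, ← Measure.prod_restrict, Measure.restrict_univ]
        rw [e]
        exact hUV
      exact Measure.ae_ae_of_ae_prod h
    have hall : ∀ᵐ s ∂(volume.restrict (Iio (0 : ℝ))), ∀ n : ℕ, s ∈ Ioo (-((n : ℝ) + 1) ^ 2) 0 →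
        ∫⁻ y in ball (0 : (EuclideanSpace ℝ (Fin 3))) ((n : ℝ) + 1), ‖U s y‖ₑ ^ 2 / ‖y - x₀‖ₑ ≤ K := by
      rw [ae_all_iff]
      intro n
      have h := hUH n
      rw [ae_restrict_iff' measurableSet_Ioo] at h
      exact ae_restrict_of_ae h
    filter_upwards [hall, hUVs, ae_restrict_mem measurableSet_Iio] with s hs hsV hs0
    have hs0' : s < 0 := hs0
    -- the bound on every ball, for the slice of `V`
    have hballn : ∀ n : ℕ, ∫⁻ y in ball (0 : (EuclideanSpace ℝ (Fin 3))) ((n : ℝ) + 1), ‖V s y‖ₑ ^ 2 / ‖y - x₀‖ₑ ≤ K := by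
      intro n
      obtain ⟨N₀, hN₀⟩ := exists_nat_ge (-s)
      set N : ℕ := max n N₀ with hN
      have hNn : (n : ℝ) + 1 ≤ (N : ℝ) + 1 := by
        have : (n : ℝ) ≤ N := by exact_mod_cast le_max_left n N₀
        linarith
      have hsN : s ∈ Ioo (-((N : ℝ) + 1) ^ 2) 0 := by
        refine ⟨?_, hs0'⟩
        have h1 : (N₀ : ℝ) ≤ N := by exact_mod_cast le_max_right n N₀
        nlinarith
      have e : ∫⁻ y in ball (0 : (EuclideanSpace ℝ (Fin 3))) ((N : ℝ) + 1), ‖V s y‖ₑ ^ 2 / ‖y - x₀‖ₑ =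
          ∫⁻ y in ball (0 : (EuclideanSpace ℝ (Fin 3))) ((N : ℝ) + 1), ‖U s y‖ₑ ^ 2 / ‖y - x₀‖ₑ := by
        refine lintegral_congr_ae ?_
        filter_upwards [ae_restrict_of_ae (s := ball (0 : (EuclideanSpace ℝ (Fin 3))) ((N : ℝ) + 1)) hsV] with y hy
        rw [hy]
      calc ∫⁻ y in ball (0 : (EuclideanSpace ℝ (Fin 3))) ((n : ℝ) + 1), ‖V s y‖ₑ ^ 2 / ‖y - x₀‖ₑ
          ≤ ∫⁻ y in ball (0 : (EuclideanSpace ℝ (Fin 3))) ((N : ℝ) + 1), ‖V s y‖ₑ ^ 2 / ‖y - x₀‖ₑ :=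
            lintegral_mono_set (ball_subset_ball hNn)
        _ = _ := e
        _ ≤ K := hs N hsN
    -- exhaust `(EuclideanSpace ℝ (Fin 3))` by the balls
    have hdir : Directed (· ⊆ ·) (fun n : ℕ => ball (0 : (EuclideanSpace ℝ (Fin 3))) ((n : ℝ) + 1)) := by
      refine Monotone.directed_le fun a b hab => ball_subset_ball ?_
      have : (a : ℝ) ≤ b := by exact_mod_cast hab
      linarith
    rw [← setLIntegral_univ, ← iUnion_ball_nat_succ (0 : (EuclideanSpace ℝ (Fin 3))), setLIntegral_iUnion_of_directed _ hdir]
    exact iSup_le hballn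

/-- **Item stmt-NavierStokesRegularity-7983 (`ABForwardHardy`) holds** — Albritton–Barker 2019,
Thm. 1.1, forward direction, carrying the Hardy bound through the blow-up
(`exists_hardyAncient_of_localTypeI`). [cite: AlbrittonBarker2019, Thm 1.1 and §3; SereginSverak2009, Thm 2.8] -/
theorem abForwardHardy_proof :
    Summit.NavierStokesRegularity.NavierStokesRegularity.Theses.HardyPointSink.ABForwardHardy := by
  rintro ⟨r₀, z, u, p, hloc, K, hH⟩
  obtain ⟨V, P, H, h1, h2, h3, h4, h5, h6, h7⟩ := exists_hardyAncient_of_localTypeI hloc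
  exact ⟨V, P, H, h1, h2, h3, h4, h5, h6, K, h7 K hH⟩

/-- **Albritton–Barker 2019, Thm. 1.1, forward direction** (the tree's named fact
`Literature.Analysis.FluidPDE.AlbrittonBarkerForward`: a suitable weak solution with a Type I
singular point yields a non-trivial mild bounded ancient solution with `𝐈 < ∞`), as the
Hardy-free part of `exists_hardyAncient_of_localTypeI`. [cite: AlbrittonBarker2019, Thm 1.1 (forward direction), §3] -/
theorem albrittonBarkerForward_proof : Literature.Analysis.FluidPDE.AlbrittonBarkerForward := by
  rintro ⟨r₀, z, u, p, hloc⟩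
  obtain ⟨V, P, H, -, h2, h3, h4, h5, h6, -⟩ := exists_hardyAncient_of_localTypeI hloc
  exact ⟨V, P, H, h2, h3, h4, h5, h6⟩

end Summit.NavierStokesRegularity.NavierStokesRegularity.Theorems

end
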